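import Literature.NumberTheory.PAdicHodge.AinfTopology
import HarnessLib

/-!
# Points of formal groups with values in `𝔸_inf(F)`: evaluation of power series on `𝔫 = θ⁻¹(𝔪_{ℂ_F})`,
# compatibility with `θ` and `Γ_F`, and the congruence lemma

Topic `Literature/NumberTheory/PAdicHodge`; sequel of `AinfTopology`. A formal group law `𝔉` with coefficients in
a (discretely topologised) ring `A` mapping to `𝔸_inf` — fixed by `Γ_F` and compatible with `θ` (e.g. `ℤ`,
`ℤ_p`) — is evaluated at elements of the closed nil ideal `𝔫 = θ⁻¹(𝔪_{ℂ_F}) ⊂ 𝔸_inf(F)` (tree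
`AinfTop.nilTheta`, `LubinTate.evalPt` / `addPt`, Mathlib `MvPowerSeries.aeval`), making `𝔉(𝔫)` an
associative commutative monoid (tree `LubinTate.addPt_assoc` / `addPt_comm`, Cassels–Fröhlich VI §3.2)
mapping onto `𝔉(𝔪_{ℂ_F})` by `θ` and acted on by `Γ_F`. This is the setting of Fontaine's and Colmez's
`p`-adic periods of formal groups (Fontaine 1977 Ch. V, Colmez 1992 §2); here:

* §4 compatibilities: `θ(f(x)) = f(θ x)` (`theta_aeval`, `theta_evalPt`, `theta_addPt`: `θ : 𝔉(𝔫) → 𝔉(𝔪_{ℂ_F})`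
  is a homomorphism) and `σ(f(x)) = f(σ x)` for `Γ_F`-invariant coefficients (`gal_aeval`, `gal_evalPt`,
  `gal_addPt`), from Mathlib's `MvPowerSeries.comp_aeval` and the continuity of `θ`, `σ` (`AinfTopology`).
* §5 the congruence lemma `x ≡ y (mod J) ⇒ f(x) ≡ f(y) (mod J)` for a CLOSED ideal `J` of `𝔸_inf` — e.g. any
  ideal containing a power of `(p, ξ)` — (`aeval_sub_aeval_mem`, `evalPt_sub_evalPt_mem`,
  `addPt_sub_addPt_mem`): the input of Fontaine's limit `lim [pⁿ]_𝔉(ûₙ)` (sequel).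

Definitions (reviewed): `AinfTop.thetaAlgHom`, `AinfTop.galAlgHom` (the `A`-algebra structures on `θ`, `σ`).
No named facts, no `sorry`. Infrastructure for the supersingular sector of hDR; nothing about elliptic curves
is proved here.

## References
* J.-P. Serre, *Local class field theory* (Cassels–Fröhlich Ch. VI) §3.2: points of a formal group with
  values in a complete ring. [CasselsFrohlichANT1967]
* J.-M. Fontaine, *Le corps des périodes p-adiques*, Astérisque 223 (1994), Exp. II §1.2–§1.3. [FontaineAsterisque223III]
-/

noncomputable section

open Ideal WittVector MvPowerSeries Field

namespace Literature.NumberTheory.PAdicHodge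

open Literature.NumberTheory.GaloisRepresentations
open Literature.NumberTheory.GaloisRepresentations.IsNonarchimedeanLocalField
open Literature.NumberTheory.GaloisRepresentations.LubinTate

variable (F : Type) [Field F] [ValuativeRel F] [TopologicalSpace F] [IsNonarchimedeanLocalField F]
  (p : ℕ) [Fact p.Prime] [Fact (¬ IsUnit (p : integerC F))]
  [IsAdicComplete (Ideal.span {(p : integerC F)}) (integerC F)]

/-! ## §4 Evaluation of power series on `𝔫`: compatibility with `θ` and with `Γ_F` -/


section Congr

variable {A : Type*} [CommRing A] [UniformSpace A] [IsUniformAddGroup A] [IsTopologicalRing A]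
  {S : Type*} [CommRing S] [UniformSpace S]
  [IsUniformAddGroup S] [IsTopologicalRing S] [IsLinearTopology S S] [T2Space S] [CompleteSpace S]
  [Algebra A S] [ContinuousSMul A S]

/-- `aeval` at equal point families (transport of the `HasEval` witness). [cite: CasselsFrohlichANT1967, Ch. VI §3.2] -/
theorem aeval_congr_point {σ : Type*} {a b : σ → S} (ha : HasEval a) (hb : HasEval b)
    (h : a = b) (f : MvPowerSeries σ A) : aeval ha f = aeval hb f := by
  subst h; rfl

end Congr

namespace AinfTop

variable {F p} [CharZero F]

section EvalTheta

variable {A : Type*} [CommRing A] [UniformSpace A] [DiscreteUniformity A]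
  [Algebra A (AinfTop F p)] [ContinuousSMul A (AinfTop F p)] [Algebra A (CBall F)] [ContinuousSMul A (CBall F)]

omit [CharZero F] in
/-- `θ` as an `A`-algebra homomorphism, for a coefficient ring `A` mapping compatibly to `𝔸_inf` and `𝒪_{ℂ_F}`.
[folklore] -/
def thetaAlgHom (hA : ∀ a : A, theta F p (algebraMap A (AinfTop F p) a) = algebraMap A (CBall F) a) :
    AinfTop F p →ₐ[A] CBall F :=
  { theta F p with commutes' := hA }

omit [CharZero F] [UniformSpace A] [DiscreteUniformity A] [ContinuousSMul A (AinfTop F p)]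
  [ContinuousSMul A (CBall F)] in
/-- Unfolding `thetaAlgHom`. [cite: FontaineAsterisque223III, Exp. II §1.2.2] -/
@[simp] theorem thetaAlgHom_apply (hA : ∀ a : A, theta F p (algebraMap A (AinfTop F p) a) = algebraMap A (CBall F) a)
    (z : AinfTop F p) : thetaAlgHom hA z = theta F p z := rfl

/-- **`θ` commutes with evaluation**: `θ(f(x)) = f(θ(x))` for a power series `f` over `A` and a topologically
nilpotent family `x` in `𝔸_inf` (Mathlib `MvPowerSeries.comp_aeval`, `θ` continuous). [cite: CasselsFrohlichANT1967, Ch. VI §3.2] -/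
theorem theta_aeval (hA : ∀ a : A, theta F p (algebraMap A (AinfTop F p) a) = algebraMap A (CBall F) a)
    {ι : Type*} {x : ι → AinfTop F p} (hx : HasEval x) (f : MvPowerSeries ι A) :
    theta F p (aeval hx f) = aeval (hx.map (φ := (thetaAlgHom hA : AinfTop F p →+* CBall F)) continuous_theta) f := by
  have h := MvPowerSeries.comp_aeval hx (ε := thetaAlgHom hA) continuous_theta
  exact AlgHom.congr_fun h f

/-- **`θ : 𝔉(𝔫) → 𝔉(𝔪_{ℂ_F})` on evaluations**: `θ(f(x)) = f(θ x)` as points. [cite: CasselsFrohlichANT1967, Ch. VI §3.2] -/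
theorem theta_evalPt {hθ : Function.Surjective (fontaineTheta (integerC F) p)}
    (hA : ∀ a : A, theta F p (algebraMap A (AinfTop F p) a) = algebraMap A (CBall F) a)
    {ι : Type*} [Finite ι] (f : MvPowerSeries ι A) (hf : f.constantCoeff = 0)
    (x : ι → (nilTheta F p hθ).toIdeal) (y : ι → (maxNilIdealC F).toIdeal)
    (hxy : ∀ i, theta F p (x i : AinfTop F p) = y i) :
    theta F p (evalPt (nilTheta F p hθ) f hf x : AinfTop F p) = (evalPt (maxNilIdealC F) f hf y : CBall F) := by
  rw [coe_evalPt, coe_evalPt, theta_aeval hA ((nilTheta F p hθ).hasEval x) f]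
  exact aeval_congr_point _ _ (funext fun i => hxy i) f

/-- **`θ` is a homomorphism of formal-group points**: `θ(x +_𝔉 y) = θ(x) +_𝔉 θ(y)` for every formal group law
`𝔉` over `A`. [cite: CasselsFrohlichANT1967, Ch. VI §3.2] -/
theorem theta_addPt {hθ : Function.Surjective (fontaineTheta (integerC F) p)}
    (hA : ∀ a : A, theta F p (algebraMap A (AinfTop F p) a) = algebraMap A (CBall F) a)
    (G : FormalGroup A) (x y : (nilTheta F p hθ).toIdeal) :
    theta F p (addPt (nilTheta F p hθ) G x y : AinfTop F p) =
      (addPt (maxNilIdealC F) G ⟨theta F p x, theta_mem_maxNilIdealC x.2⟩ ⟨theta F p y, theta_mem_maxNilIdealC y.2⟩ :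
        CBall F) :=
  theta_evalPt hA G.toPowerSeries G.zero_constantCoeff ![x, y]
    ![⟨theta F p x, theta_mem_maxNilIdealC x.2⟩, ⟨theta F p y, theta_mem_maxNilIdealC y.2⟩]
    fun i => by fin_cases i <;> rfl

end EvalTheta

section EvalGal

variable {A : Type*} [CommRing A] [UniformSpace A] [DiscreteUniformity A]
  [Algebra A (AinfTop F p)] [ContinuousSMul A (AinfTop F p)]

/-- `σ ∈ Γ_F` as an `A`-algebra endomorphism of `AinfTop`, for coefficients fixed by `σ`. [folklore] -/
def galAlgHom (σ : absoluteGaloisGroup F) (hσ : ∀ a : A, gal F p σ (algebraMap A (AinfTop F p) a) = algebraMap A (AinfTop F p) a) :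
    AinfTop F p →ₐ[A] AinfTop F p :=
  { gal F p σ with commutes' := hσ }

omit [IsAdicComplete (Ideal.span {(p : integerC F)}) (integerC F)] [CharZero F] [UniformSpace A]
  [DiscreteUniformity A] [ContinuousSMul A (AinfTop F p)] in
/-- Unfolding `galAlgHom`. [cite: FontaineAsterisque223III, Exp. II §1.2] -/
@[simp] theorem galAlgHom_apply (σ : absoluteGaloisGroup F)
    (hσ : ∀ a : A, gal F p σ (algebraMap A (AinfTop F p) a) = algebraMap A (AinfTop F p) a) (z : AinfTop F p) :
    galAlgHom σ hσ z = gal F p σ z := rfl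

/-- **`Γ_F` commutes with evaluation**: `σ(f(x)) = f(σ x)` when `σ` fixes the coefficients.
[cite: FontaineAsterisque223III, Exp. II §1.2] -/
theorem gal_aeval (σ : absoluteGaloisGroup F)
    (hσ : ∀ a : A, gal F p σ (algebraMap A (AinfTop F p) a) = algebraMap A (AinfTop F p) a)
    {ι : Type*} {x : ι → AinfTop F p} (hx : HasEval x) (f : MvPowerSeries ι A) :
    gal F p σ (aeval hx f) = aeval (hx.map (φ := (galAlgHom σ hσ : AinfTop F p →+* AinfTop F p)) (continuous_gal σ)) f := by
  have h := MvPowerSeries.comp_aeval hx (ε := galAlgHom σ hσ) (continuous_gal σ)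
  exact AlgHom.congr_fun h f

/-- `σ(f(x)) = f(σ x)` as points of `𝔫`. [cite: FontaineAsterisque223III, Exp. II §1.2] -/
theorem gal_evalPt {hθ : Function.Surjective (fontaineTheta (integerC F) p)} (σ : absoluteGaloisGroup F)
    (hσ : ∀ a : A, gal F p σ (algebraMap A (AinfTop F p) a) = algebraMap A (AinfTop F p) a)
    {ι : Type*} [Finite ι] (f : MvPowerSeries ι A) (hf : f.constantCoeff = 0)
    (x y : ι → (nilTheta F p hθ).toIdeal) (hxy : ∀ i, gal F p σ (x i : AinfTop F p) = y i) :
    gal F p σ (evalPt (nilTheta F p hθ) f hf x : AinfTop F p) = (evalPt (nilTheta F p hθ) f hf y : AinfTop F p) := by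
  rw [coe_evalPt, coe_evalPt, gal_aeval σ hσ ((nilTheta F p hθ).hasEval x) f]
  exact aeval_congr_point _ _ (funext fun i => hxy i) f

/-- **`Γ_F` acts on `𝔉(𝔫)` by group homomorphisms**: `σ(x +_𝔉 y) = σx +_𝔉 σy`.
[cite: FontaineAsterisque223III, Exp. II §1.2] -/
theorem gal_addPt {hθ : Function.Surjective (fontaineTheta (integerC F) p)} (σ : absoluteGaloisGroup F)
    (hσ : ∀ a : A, gal F p σ (algebraMap A (AinfTop F p) a) = algebraMap A (AinfTop F p) a)
    (G : FormalGroup A) (x y : (nilTheta F p hθ).toIdeal) :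
    gal F p σ (addPt (nilTheta F p hθ) G x y : AinfTop F p) =
      (addPt (nilTheta F p hθ) G ⟨gal F p σ x, gal_mem_nilTheta σ x.2⟩ ⟨gal F p σ y, gal_mem_nilTheta σ y.2⟩ :
        AinfTop F p) :=
  gal_evalPt σ hσ G.toPowerSeries G.zero_constantCoeff ![x, y]
    ![⟨gal F p σ x, gal_mem_nilTheta σ x.2⟩, ⟨gal F p σ y, gal_mem_nilTheta σ y.2⟩]
    fun i => by fin_cases i <;> rfl

/-! ## §5 The congruence lemma: `x ≡ y (mod J)` ⇒ `f(x) ≡ f(y) (mod J)` for closed `J` -/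

/-- **Congruence lemma.** If `J` is a closed ideal of `𝔸_inf` (e.g. any ideal containing a power of `(p, ξ)`)
and `x ≡ y (mod J)` componentwise, then `f(x) ≡ f(y) (mod J)` for every power series `f` over `A`: the
partial sums agree modulo `J` and `J` is closed. [cite: CasselsFrohlichANT1967, Ch. VI §3.2] -/
theorem aeval_sub_aeval_mem {J : Ideal (AinfTop F p)} (hJ : IsClosed (J : Set (AinfTop F p)))
    {ι : Type*} {x y : ι → AinfTop F p} (hx : HasEval x) (hy : HasEval y) (h : ∀ i, x i - y i ∈ J)
    (f : MvPowerSeries ι A) : aeval hx f - aeval hy f ∈ J := by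
  have h3 := (hasSum_aeval hx f).sub (hasSum_aeval hy f)
  refine hJ.mem_of_tendsto h3 (Filter.Eventually.of_forall fun s => ?_)
  refine Submodule.sum_mem _ fun d _ => ?_
  rw [← smul_sub, Algebra.smul_def]
  refine Ideal.mul_mem_left _ _ ?_
  rw [← Ideal.Quotient.eq, map_finsuppProd, map_finsuppProd]
  refine Finsupp.prod_congr fun i _ => ?_
  rw [map_pow, map_pow, Ideal.Quotient.eq.2 (h i)]

/-- Congruence lemma on points of `𝔫`. [cite: CasselsFrohlichANT1967, Ch. VI §3.2] -/
theorem evalPt_sub_evalPt_mem {hθ : Function.Surjective (fontaineTheta (integerC F) p)}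
    {J : Ideal (AinfTop F p)} (hJ : IsClosed (J : Set (AinfTop F p)))
    {ι : Type*} [Finite ι] (f : MvPowerSeries ι A) (hf : f.constantCoeff = 0)
    (x y : ι → (nilTheta F p hθ).toIdeal) (h : ∀ i, (x i : AinfTop F p) - y i ∈ J) :
    (evalPt (nilTheta F p hθ) f hf x : AinfTop F p) - evalPt (nilTheta F p hθ) f hf y ∈ J :=
  aeval_sub_aeval_mem hJ _ _ h f

/-- **Formal-group addition is congruence-continuous**: `x ≡ x'`, `y ≡ y' (mod J)` ⇒ `x +_𝔉 y ≡ x' +_𝔉 y' (mod J)`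
for `J` closed. [cite: CasselsFrohlichANT1967, Ch. VI §3.2] -/
theorem addPt_sub_addPt_mem {hθ : Function.Surjective (fontaineTheta (integerC F) p)}
    {J : Ideal (AinfTop F p)} (hJ : IsClosed (J : Set (AinfTop F p)))
    (G : FormalGroup A) {x x' y y' : (nilTheta F p hθ).toIdeal}
    (hx : (x : AinfTop F p) - x' ∈ J) (hy : (y : AinfTop F p) - y' ∈ J) :
    (addPt (nilTheta F p hθ) G x y : AinfTop F p) - addPt (nilTheta F p hθ) G x' y' ∈ J :=
  evalPt_sub_evalPt_mem hJ G.toPowerSeries G.zero_constantCoeff ![x, y] ![x', y']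
    fun i => by fin_cases i <;> assumption

end EvalGal

end AinfTop

end Literature.NumberTheory.PAdicHodge

end
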